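import Mathlib
import Literature.Barriers.ValiantsHypothesis.AlgebraicNaturalProofs
import Literature.Computability.AlgebraicComplexity.RazUniversalCircuits
import Literature.Computability.AlgebraicComplexity.ValiantClasses
import Literature.Computability.AlgebraicComplexity.DetInVP
import Literature.Computability.AlgebraicComplexity.ArithCircuitProofs
import Literature.Computability.AlgebraicComplexity.IMMInVPProofs
import Literature.Computability.AlgebraicComplexity.HamiltonianCycleVNP
import Summits.ValiantsHypothesis.ValiantsHypothesis.Theorems.BarrierLeverDefinableEquationsDefs

/-!
# Crux `BarrierLever.DefinableEquations` (stmt-ValiantsHypothesis-8745), line `registered` —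
# stub `stub_signGadget` (V1): the sign gadget of the Valiant-criterion witness

For a tableau-contraction datum `τ` (`TabDatum`), the sign
`ε_τ(i) = ∏_j det M_j(i)`, `M_j(i)_{a b} = [∀ p ∈ cell j a, i p = tmpl j b p]`, of an index
function `i : Fin τ.D × Fin n → Fin n` is the value, at the one-hot point of `i`
(`boolPt (oneHot i)`: the Boolean variable `((k, pos), l)` is `1` iff `i (k, pos) = l`), of the
polynomial

  `G = ∏_{j < τ.L} det ( ∏_{p ∈ cell j a} X_{(p, tmpl j b p)} )_{a, b < size j}`

on the Boolean block `BPos τ.D n` (a product of determinants of matrices with monomial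
entries): the `(a, b)` entry evaluates to `∏_{p ∈ cell j a} [i p = tmpl j b p]` which is the
indicator of `M_j(i)_{a b}`, and `aeval` commutes with `det`.  Writing each determinant as the
generic determinant `detPoly` (Berkowitz: `complexity_detPoly_le`, `L(DET_s) ≤ 8 (s+1)⁷`)
substituted with the monomial entries (`complexity_aeval_le`) gives, for a `B`-bounded datum,
`L(G) ≤ B (8 (B+1)⁷ + B² · B n) + B ≤ (B+n+2)¹²` and `deg G ≤ B · B · B n ≤ (B+n+2)⁴`; this is
`signSpec n τ B`.

References: P. Bürgisser, *Completeness and Reduction in Algebraic Complexity Theory* (2000),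
Prop. 2.20 (Valiant's criterion) and Rem. 2.7 (substitution); S. J. Berkowitz, Inform. Process.
Lett. 18 (1984) (`DET ∈ VP`).
-/

noncomputable section

-- single-conjunct layout: Sub = Summit, duplicated namespace component intended
set_option linter.dupNamespace false

namespace Summit.ValiantsHypothesis.ValiantsHypothesis.Theorems.BarrierLeverDefinableEquations

open MvPolynomial
open Literature.Computability.AlgebraicComplexity Literature.Barriers.ValiantsHypothesis

namespace SignGadget

/-! ### Determinants of matrices of polynomials: size and degree -/

section Det

variable {σ : Type*} {s : ℕ}

/-- The determinant of a matrix of polynomials is the generic determinant `detPoly` with the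
entries substituted (`Matrix.mvPolynomialX_mapMatrix_aeval`, `AlgHom.map_det`). [folklore] -/
theorem det_eq_aeval_detPoly (A : Matrix (Fin s) (Fin s) (MvPolynomial σ ℂ)) :
    A.det = aeval (fun p : Fin s × Fin s => A p.1 p.2) (detPoly (Fin s) ℂ) := by
  rw [detPoly, AlgHom.map_det, Matrix.mvPolynomialX_mapMatrix_aeval]

/-- `L(det A) ≤ 8 (s+1)⁷ + s² c` for an `s × s` matrix `A` of polynomials of complexity `≤ c`
(Berkowitz `complexity_detPoly_le` and the substitution bound `complexity_aeval_le`).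
[folklore] -/
theorem complexity_det_le {c : ℕ} (A : Matrix (Fin s) (Fin s) (MvPolynomial σ ℂ))
    (h : ∀ a b, complexity (A a b) ≤ c) :
    complexity A.det ≤ 8 * (s + 1) ^ 7 + s * s * c := by
  rw [det_eq_aeval_detPoly]
  refine (complexity_aeval_le _ _).trans (add_le_add (complexity_detPoly_le ℂ s) ?_)
  refine (Finset.sum_le_sum fun p _ => h p.1 p.2).trans ?_
  simp

/-- `deg (det A) ≤ s · d` for an `s × s` matrix `A` of polynomials of degree `≤ d`
(Leibniz expansion `Matrix.det_apply`). [folklore] -/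
theorem totalDegree_det_le {d : ℕ} (A : Matrix (Fin s) (Fin s) (MvPolynomial σ ℂ))
    (h : ∀ a b, (A a b).totalDegree ≤ d) : A.det.totalDegree ≤ s * d := by
  rw [Matrix.det_apply]
  refine totalDegree_sum_le_of_le _ _ _ fun π _ => ?_
  rw [Units.smul_def, zsmul_eq_mul, ← map_intCast (C : ℂ →+* MvPolynomial σ ℂ)]
  refine (totalDegree_mul _ _).trans ?_
  rw [totalDegree_C, zero_add]
  refine (totalDegree_prod_le_of_le _ _ d fun a _ => h _ _).trans ?_
  rw [Finset.card_univ, Fintype.card_fin]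

end Det

/-! ### The monomial entries of the gadget -/

section Entry

variable {n D : ℕ}

/-- An entry `∏_{p ∈ cell} X_{(p, t p)}` costs nothing but its `≤ D n` multiplications.
[folklore] -/
theorem complexity_entry_le (cell : Finset (Fin D × Fin n)) (t : Fin D × Fin n → Fin n) :
    complexity (∏ p ∈ cell,
      (X (Sum.inr (p, t p)) : MvPolynomial (topMonomials n ⊕ BPos D n) ℂ)) ≤ D * n := by
  refine (complexity_prod_le_of_le _ _ 0 fun _ _ => le_of_eq (complexity_X_holds _)).trans ?_
  rw [mul_zero, zero_add]
  simpa using cell.card_le_univ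

/-- An entry `∏_{p ∈ cell} X_{(p, t p)}` has degree `≤ D n`. [folklore] -/
theorem totalDegree_entry_le (cell : Finset (Fin D × Fin n)) (t : Fin D × Fin n → Fin n) :
    (∏ p ∈ cell,
      (X (Sum.inr (p, t p)) : MvPolynomial (topMonomials n ⊕ BPos D n) ℂ)).totalDegree ≤
      D * n := by
  refine (totalDegree_prod_le_of_le _ _ 1 fun _ _ => totalDegree_X_le_one _).trans ?_
  rw [mul_one]
  simpa using cell.card_le_univ

/-- At the one-hot point of `i` the entry `∏_{p ∈ cell} X_{(p, t p)}` is the indicator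
`[∀ p ∈ cell, i p = t p]` (`Finset.prod_boole`). [folklore] -/
theorem aeval_entry (i : Fin D × Fin n → Fin n) (cell : Finset (Fin D × Fin n))
    (t : Fin D × Fin n → Fin n) :
    aeval (boolPt (σ := topMonomials n) (oneHot i)) (∏ p ∈ cell,
      (X (Sum.inr (p, t p)) : MvPolynomial (topMonomials n ⊕ BPos D n) ℂ)) =
      if ∀ p ∈ cell, i p = t p then 1 else 0 := by
  rw [map_prod]
  simp [boolPt, oneHot, Finset.prod_boole]

end Entry

/-! ### Numeric bounds -/

/-- `B (8 (B+1)⁷ + B² (B n)) + B ≤ P¹²` once `B + 1, n ≤ P` and `2 ≤ P`. [folklore] -/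
theorem bound_twelve {B n P : ℕ} (hB : B ≤ P) (hB1 : B + 1 ≤ P) (hn : n ≤ P) (h2 : 2 ≤ P) :
    B * (8 * (B + 1) ^ 7 + B * B * (B * n)) + B ≤ P ^ 12 := by
  have h1 : 1 ≤ P := by omega
  have e5 : P ^ 5 ≤ P ^ 8 := Nat.pow_le_pow_right h1 (by norm_num)
  have e1 : P ≤ P ^ 8 := (pow_one P).symm.le.trans (Nat.pow_le_pow_right h1 (by norm_num))
  have e16 : 16 * P ^ 8 ≤ P ^ 12 :=
    calc 16 * P ^ 8 = 2 ^ 4 * P ^ 8 := by norm_num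
      _ ≤ P ^ 4 * P ^ 8 := Nat.mul_le_mul_right _ (Nat.pow_le_pow_left h2 4)
      _ = P ^ 12 := by ring
  calc B * (8 * (B + 1) ^ 7 + B * B * (B * n)) + B
      ≤ P * (8 * P ^ 7 + P * P * (P * n)) + P := by gcongr
    _ ≤ P * (8 * P ^ 7 + P * P * (P * P)) + P := by gcongr
    _ = 8 * P ^ 8 + P ^ 5 + P := by ring
    _ ≤ P ^ 12 := by omega

/-- `B (B (B n)) ≤ P⁴` once `B, n ≤ P`. [folklore] -/
theorem bound_four {B n P : ℕ} (hB : B ≤ P) (hn : n ≤ P) : B * (B * (B * n)) ≤ P ^ 4 :=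
  calc B * (B * (B * n)) ≤ P * (P * (P * P)) := by gcongr
    _ = P ^ 4 := by ring

end SignGadget

open SignGadget in
/-- **V1 — the sign gadget.** For a `B`-bounded tableau-contraction datum `τ` the polynomial
`G = ∏_j det (∏_{p ∈ cell j a} X_{(p, tmpl j b p)})_{a b}` on the one-hot Boolean block has
`L(G) ≤ (B+n+2)¹²`, `deg G ≤ (B+n+2)⁴`, and value `ε_τ(i) = ∏_j det M_j(i)` at the one-hot
point of every index function `i` (`signSpec n τ B`). [folklore] -/
theorem stub_signGadget :
    ∀ (n : ℕ) (τ : TabDatum n) (B : ℕ), τ.Bounded B → signSpec n τ B := by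
  intro n τ B hB
  obtain ⟨hD, hL, hs⟩ := hB
  have hP : B ≤ B + n + 2 := by omega
  refine ⟨∏ j : Fin τ.L, (Matrix.of fun a b : Fin (τ.size j) => ∏ p ∈ τ.cell j a,
      (X (Sum.inr (p, τ.tmpl j b p)) : MvPolynomial (topMonomials n ⊕ BPos τ.D n) ℂ)).det,
    ?_, ?_, ?_⟩
  · -- size
    refine (complexity_prod_le_of_le _ _ (8 * (B + 1) ^ 7 + B * B * (B * n))
      fun j _ => ?_).trans ?_
    · have hsj := hs j
      refine (complexity_det_le _ fun a b => complexity_entry_le (τ.cell j a) (τ.tmpl j b)).trans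
        ?_
      gcongr
    · rw [Finset.card_univ, Fintype.card_fin]
      calc τ.L * (8 * (B + 1) ^ 7 + B * B * (B * n)) + τ.L
          ≤ B * (8 * (B + 1) ^ 7 + B * B * (B * n)) + B := by gcongr
        _ ≤ (B + n + 2) ^ 12 := bound_twelve hP (by omega) (by omega) (by omega)
  · -- degree
    refine (totalDegree_prod_le_of_le _ _ (B * (B * n)) fun j _ => ?_).trans ?_
    · have hsj := hs j
      refine (totalDegree_det_le _ fun a b =>
        totalDegree_entry_le (τ.cell j a) (τ.tmpl j b)).trans ?_
      gcongr
    · rw [Finset.card_univ, Fintype.card_fin]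
      calc τ.L * (B * (B * n)) ≤ B * (B * (B * n)) := by gcongr
        _ ≤ (B + n + 2) ^ 4 := bound_four hP (by omega)
  · -- value at the one-hot point of `i`
    intro i
    rw [map_prod, map_intCast, TabDatum.sign, Int.cast_prod]
    refine Finset.prod_congr rfl fun j _ => ?_
    rw [AlgHom.map_det, Int.cast_det]
    congr 1
    refine Matrix.ext fun a b => ?_
    simp only [AlgHom.mapMatrix_apply, Matrix.map_apply, Matrix.of_apply, Int.cast_ite,
      Int.cast_one, Int.cast_zero]
    exact aeval_entry i (τ.cell j a) (τ.tmpl j b)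

end Summit.ValiantsHypothesis.ValiantsHypothesis.Theorems.BarrierLeverDefinableEquations

end
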